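import Mathlib
import HarnessLib
import Literature.Geometry.Lorentzian.KerrConvergence

/-!
# Stub `stub_coneTimelike` (route StarvedNecks, crux `FutureOrientedOfSeamed`, line `Sketch`)

Pointwise timelikeness of a pushed-forward coordinate vector from a `C⁰` bound on the metric
deviation: if `g_B(z)(W, W) ≤ −1`, `‖W‖² ≤ 13 K` and `‖(Ψ^*g − g_B)(z)‖ ≤ 1/(20K)`, then
`g(dΨ W, dΨ W) = g_B(z)(W, W) + (Ψ^*g − g_B)(z)(W, W) ≤ −1 + 13/20 < 0`.

Reference: B. O'Neill, *Semi-Riemannian geometry*, Academic Press 1983, Ch. 5, Lemma 5.26.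
-/

noncomputable section

set_option linter.dupNamespace false
-- instance search through nested operator types `E4 →L[ℝ] E4 →L[ℝ] ℝ`
set_option maxSynthPendingDepth 3

open Set Filter Topology Function
open scoped Manifold ContDiff ENNReal Topology
open Literature.Geometry.Lorentzian

namespace Summit.FinalStateConjecture.FinalStateConjecture.Theorems.FutureOrientedOfSeamed.ClockDualityRays

/-- **Pointwise timelikeness from the `C⁰` deviation.** For a chart `Ψ : B.domain → 𝓢` on a
model background `B`, a point `z` and a coordinate vector `W` with `g_B(z)(W, W) ≤ −1`,
`‖W‖² ≤ 13 K` (`K > 0`) and operator-norm deviation `‖(Ψ^*g − g_B)(z)‖ ≤ 1/(20 K)`, the pushed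
forward vector `dΨ_z W` is timelike:
`g(dΨ W, dΨ W) = g_B(z)(W, W) + (Ψ^*g − g_B)(z)(W, W) ≤ −1 + ‖dev‖ ‖W‖² ≤ −1 + 13/20 < 0`.
O'Neill 1983, Ch. 5, Lemma 5.26 (timelike = negative square norm; the estimate is elementary).
[folklore] -/
theorem stub_coneTimelike (𝓢 : Spacetime.{0} 4) (B : ModelBackground) (Ψ : B.domain → 𝓢.carrier)
    (z : B.domain) (W : E4) {K : ℝ} (hK : 0 < K) (hB : B.bilin z.1 W W ≤ -1)
    (hW : ‖W‖ ^ 2 ≤ 13 * K) (hdev : ‖𝓢.deviation B Ψ z‖ ≤ 1 / (20 * K)) :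
    𝓢.metric.IsTimelike (mfderiv 𝓘(ℝ, E4) (𝓡 4) Ψ z W) := by
  -- adapted from Cruxes/FutureOrientedOfSeamed/LeverKitIdeator1.lean
  -- (`isTimelike_mfderiv_of_norm_deviation_le`)
  have happ := 𝓢.deviation_apply B Ψ z W W
  have h1 : 𝓢.deviation B Ψ z W W ≤ ‖𝓢.deviation B Ψ z‖ * ‖W‖ * ‖W‖ := by
    have h0 : ‖𝓢.deviation B Ψ z W W‖ ≤ ‖𝓢.deviation B Ψ z‖ * ‖W‖ * ‖W‖ :=
      ((𝓢.deviation B Ψ z W).le_opNorm W).trans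
        (mul_le_mul_of_nonneg_right ((𝓢.deviation B Ψ z).le_opNorm W) (norm_nonneg W))
    exact (Real.le_norm_self _).trans h0
  have h2 : ‖𝓢.deviation B Ψ z‖ * ‖W‖ * ‖W‖ ≤ 1 / (20 * K) * (13 * K) := by
    rw [mul_assoc, ← sq]
    exact mul_le_mul hdev hW (sq_nonneg _) (by positivity)
  have h3 : 1 / (20 * K) * (13 * K) = 13 / 20 := by
    field_simp
  show 𝓢.metric.val (Ψ z) (mfderiv 𝓘(ℝ, E4) (𝓡 4) Ψ z W) (mfderiv 𝓘(ℝ, E4) (𝓡 4) Ψ z W) < 0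
  linarith

end Summit.FinalStateConjecture.FinalStateConjecture.Theorems.FutureOrientedOfSeamed.ClockDualityRays

end
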